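import Literature.Topology.FourManifolds.NeckConnectedSum
import Literature.Topology.FourManifolds.GluckDissolveAssembly
import HarnessLib

/-!
# Neck presentations of connected sums with EXPLICIT gluing embeddings

Topic `Literature/Topology/FourManifolds`, sibling proofs file of `NeckConnectedSum.lean`
(Kosinski, *Differential Manifolds* (1993), Ch. VI §1, p. 90 and Prop. 1.3: "connected sum is
the operation of joining two manifolds by a tube") and of `GluckDissolveAssembly.lean`. Everything
here is **proved**; no definition, no named fact (D-0026).

`isOpenGluing_connectedSumRel_of_neck` (`NeckConnectedSum.lean`) turns a neck presentation of `P`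
(a neck `ψ : Sⁿ × ℝ → P`, embeddings `e₁ : M₁ ∖ {c₁ 0} → P`, `e₂ : M₂ ∖ {c₂ 0} → P` of the capped
pieces) into an open gluing along Kervaire–Milnor's connected-sum relation, whose gluing
embeddings are the neck slides `Φ₋ ∘ e₁`, `Φ₊ ∘ e₂`; but the conclusion `IsOpenGluing …` hides
them behind an existential, and with them the fact that they AGREE WITH `e₁`, `e₂` OFF THE NECK
(the slides are the identity off `range ψ`, `exists_neckSlide`). Orientation bookkeeping across two
presentations of one manifold (the dissolution manifold `ν.Dissolve` seen as `X # ℂℙ²` and as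
`S⁴ # ℂℙ²`) needs exactly this agreement, so this file re-runs the construction keeping it:

* `exists_gluing_connectedSumRel_of_neck_explicit` — same hypotheses as
  `isOpenGluing_connectedSumRel_of_neck`, conclusion: the neck slides `Φ₁`, `Φ₂` (diffeomorphisms
  of `P`) with the six gluing properties of `(Φ₁ ∘ e₁, Φ₂ ∘ e₂)` AND the facts that `Φ₁`, `Φ₂` are
  the identity off the neck and far along the neck (`|t| ≥ 2 · NeckSlide.scale`) (the proof is
  that of `NeckConnectedSum.lean`, verbatim, with the slides retained);
* `TwoKnot.TubularNbhd.DissolveSide.exists_gluing_connectedSumRel_explicit` — the dissolution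
  manifold `M = ν.Dissolve` of a side `S` (`GluckDissolveAssembly.lean`) is glued from
  `Y ∖ {jB p}` and `ℂℙ² ∖ {q}` along the relation for the discs `(S.cOne, cTwo)` by the explicit
  embeddings `(Φ₁ ∘ S.eOne, Φ₂ ∘ S.eTwoM)`, `Φᵢ` neck slides of `M` (identity off / far along the
  neck `S.j ∘ neckV`);
* `TwoKnot.TubularNbhd.DissolveSide.inl_notMem_range_j`,
  `TwoKnot.TubularNbhd.DissolveSide.eOne_jA_eq_inl` — on the piece `A` of the knot complement the
  first embedding is `inl`: `S.eOne (S.jA a) = inl a`, and `inl a ∉ range S.j` off the tube.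

## References

* A. Kosinski, *Differential Manifolds*, Academic Press (1993), Ch. VI §1 (p. 90; Prop. 1.3).
  [cite: Kosinski1993, Ch. VI §1]
* M. Kervaire, J. Milnor, *Groups of homotopy spheres I*, Ann. of Math. 77 (1963), §2.
  [cite: KervaireMilnor1963, §2]
-/

open scoped Manifold ContDiff Topology
open Set Function Metric Filter Topology Module

noncomputable section

namespace Literature.Topology.FourManifolds

/-! ### The neck lemma with explicit embeddings -/

section Main

variable {E : Type*} [NormedAddCommGroup E] [InnerProductSpace ℝ E] {n : ℕ}
  [Fact (finrank ℝ E = n + 1)]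
  {HP : Type*} [TopologicalSpace HP] {IP : ModelWithCorners ℝ E HP}
  {P : Type*} [TopologicalSpace P] [ChartedSpace HP P]
  {EM HM : Type*} [NormedAddCommGroup EM] [NormedSpace ℝ EM] [TopologicalSpace HM]
  {IM : ModelWithCorners ℝ EM HM}
  {M₁ : Type*} [TopologicalSpace M₁] [T2Space M₁] [ChartedSpace HM M₁]
  {EN HN : Type*} [NormedAddCommGroup EN] [NormedSpace ℝ EN] [TopologicalSpace HN]
  {IN : ModelWithCorners ℝ EN HN}
  {M₂ : Type*} [TopologicalSpace M₂] [T2Space M₂] [ChartedSpace HN M₂]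

/-- **Neck presentation ⇒ explicit open gluing along the connected-sum relation, equal to the
given embeddings off the neck.** Under the hypotheses of `isOpenGluing_connectedSumRel_of_neck`
(a neck `ψ : Sⁿ × ℝ → P`; smooth embeddings `e₁ : M₁ ∖ {c₁ 0} → P`, `e₂ : M₂ ∖ {c₂ 0} → P` with
open disjoint ranges missing the middle sphere, covering `P` with it, and matching the punctured
discs with the half-necks), there are DIFFEOMORPHISMS `Φ₁`, `Φ₂` of `P` (the neck slides `Φ∓` by `t ∓ Ω t`,
`exists_neckSlide`) such that `jA := Φ₁ ∘ e₁`, `jB := Φ₂ ∘ e₂` are smooth embeddings with open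
ranges covering `P` and `jA a = jB b ↔ c₁ (t • u) ∼ c₂ ((1-t) • u)` (Kervaire–Milnor's relation),
and `Φ₁`, `Φ₂` are the identity off the neck (`p ∉ range ψ`) and far along it (at `ψ (θ, t)` with
`|t| ≥ 2 · NeckSlide.scale`). In particular the slides are the identity on a nonempty open set,
hence orientation preserving for every orientation of `P`. The proof is that of
`isOpenGluing_connectedSumRel_of_neck` with the slides kept (Kosinski VI §1, p. 90 and
Prop. 1.3). [cite: Kosinski1993, Ch. VI §1 (p. 90; Prop. 1.3)] -/
theorem exists_gluing_connectedSumRel_of_neck_explicit [T2Space P] [IsManifold IP ∞ P]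
    (c₁ : E → M₁) (c₂ : E → M₂)
    {ψ : sphere (0 : E) 1 × ℝ → P}
    (hψ : Manifold.IsSmoothEmbedding ((𝓡 n).prod 𝓘(ℝ, ℝ)) IP ∞ ψ) (hψo : IsOpen (range ψ))
    {e₁ : puncture c₁ → P} (he₁ : Manifold.IsSmoothEmbedding IM IP ∞ e₁)
    (he₁o : IsOpen (range e₁))
    {e₂ : puncture c₂ → P} (he₂ : Manifold.IsSmoothEmbedding IN IP ∞ e₂)
    (he₂o : IsOpen (range e₂))
    (hdisj : Disjoint (range e₁) (range e₂))
    (h0₁ : ∀ θ, ψ (θ, 0) ∉ range e₁) (h0₂ : ∀ θ, ψ (θ, 0) ∉ range e₂)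
    (hcover : ∀ p, p ∉ range e₁ → p ∉ range e₂ → ∃ θ, ψ (θ, 0) = p)
    (hc₁ : ∀ (θ : sphere (0 : E) 1) (t : ℝ), 0 < t →
      ∃ a : puncture c₁, (a : M₁) = c₁ (t • (θ : E)) ∧ e₁ a = ψ (θ, t))
    (hc₂ : ∀ (θ : sphere (0 : E) 1) (t : ℝ), 0 < t →
      ∃ b : puncture c₂, (b : M₂) = c₂ (t • (θ : E)) ∧ e₂ b = ψ (θ, -t)) :
    ∃ (Φ₁ Φ₂ : P ≃ₘ⟮IP, IP⟯ P),
      (Manifold.IsSmoothEmbedding IM IP ∞ (Φ₁ ∘ e₁) ∧ IsOpen (range (Φ₁ ∘ e₁)) ∧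
        Manifold.IsSmoothEmbedding IN IP ∞ (Φ₂ ∘ e₂) ∧ IsOpen (range (Φ₂ ∘ e₂)) ∧
        range (Φ₁ ∘ e₁) ∪ range (Φ₂ ∘ e₂) = univ ∧
        ∀ a b, (Φ₁ ∘ e₁) a = (Φ₂ ∘ e₂) b ↔ connectedSumRel c₁ c₂ a b) ∧
      (∀ p, p ∉ range ψ → Φ₁ p = p) ∧ (∀ p, p ∉ range ψ → Φ₂ p = p) ∧
      (∀ q : sphere (0 : E) 1 × ℝ, 2 * NeckSlide.scale ≤ |q.2| → Φ₁ (ψ q) = ψ q) ∧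
      (∀ q : sphere (0 : E) 1 × ℝ, 2 * NeckSlide.scale ≤ |q.2| → Φ₂ (ψ q) = ψ q) := by
  haveI : FiniteDimensional ℝ E := .of_fact_finrank_eq_succ (K := ℝ) (V := E) n
  have hinj : Injective ψ := hψ.isEmbedding.injective
  have hc1 : |(-1 : ℝ)| ≤ 1 := by norm_num
  have hc1' : |(1 : ℝ)| ≤ 1 := by norm_num
  -- the two slides of the line and of `P`
  set μ₁ := NeckSlide.slideDiffeo hc1 with hμ₁
  set μ₂ := NeckSlide.slideDiffeo hc1' with hμ₂
  obtain ⟨Φ₁, hΦ₁ψ, hΦ₁id⟩ := exists_neckSlide hψ hψo μ₁ (2 * NeckSlide.scale)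
    (fun t ht => NeckSlide.slideDiffeo_eq_self hc1 ht)
  obtain ⟨Φ₂, hΦ₂ψ, hΦ₂id⟩ := exists_neckSlide hψ hψo μ₂ (2 * NeckSlide.scale)
    (fun t ht => NeckSlide.slideDiffeo_eq_self hc1' ht)
  -- values of the line slides
  have hμ₁v : ∀ t, |t| ≤ 3 → μ₁ t = t - 1 / 2 := fun t ht => by
    rw [hμ₁, NeckSlide.slideDiffeo_apply_of_abs_le hc1 ht]; ring
  have hμ₂v : ∀ t, |t| ≤ 3 → μ₂ t = t + 1 / 2 := fun t ht => by
    rw [hμ₂, NeckSlide.slideDiffeo_apply_of_abs_le hc1' ht]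
  have hμ₁0 : μ₁ 0 = -(1 / 2) := by rw [hμ₁v 0 (by norm_num)]; ring
  have hμ₂0 : μ₂ 0 = 1 / 2 := by rw [hμ₂v 0 (by norm_num)]; ring
  -- where `e₁`, `e₂` can meet the neck
  have he₁ψ : ∀ a θ t, e₁ a = ψ (θ, t) → 0 < t := by
    intro a θ t h
    rcases lt_trichotomy t 0 with ht | rfl | ht
    · obtain ⟨b, -, hb⟩ := hc₂ θ (-t) (by linarith)
      rw [neg_neg] at hb
      exact absurd (hb.trans h.symm ▸ mem_range_self (f := e₂) b)
        (Set.disjoint_left.1 hdisj (mem_range_self a))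
    · exact absurd (h ▸ mem_range_self (f := e₁) a) (h0₁ θ)
    · exact ht
  have he₂ψ : ∀ b θ t, e₂ b = ψ (θ, t) → t < 0 := by
    intro b θ t h
    rcases lt_trichotomy t 0 with ht | rfl | ht
    · exact ht
    · exact absurd (h ▸ mem_range_self (f := e₂) b) (h0₂ θ)
    · obtain ⟨a, -, ha⟩ := hc₁ θ t ht
      exact absurd (h ▸ mem_range_self (f := e₂) b)
        (Set.disjoint_left.1 hdisj (ha ▸ mem_range_self (f := e₁) a))
  have he₁c : ∀ (a : puncture c₁) (θ : sphere (0 : E) 1) (t : ℝ), 0 < t → e₁ a = ψ (θ, t) →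
      (a : M₁) = c₁ (t • (θ : E)) := by
    intro a θ t ht h
    obtain ⟨a', ha', he'⟩ := hc₁ θ t ht
    rw [← he₁.isEmbedding.injective (he'.trans h.symm), ha']
  have he₂c : ∀ (b : puncture c₂) (θ : sphere (0 : E) 1) (t : ℝ), 0 < t → e₂ b = ψ (θ, -t) →
      (b : M₂) = c₂ (t • (θ : E)) := by
    intro b θ t ht h
    obtain ⟨b', hb', he'⟩ := hc₂ θ t ht
    rw [← he₂.isEmbedding.injective (he'.trans h.symm), hb']
  refine ⟨Φ₁, Φ₂, ⟨he₁.diffeomorph_comp Φ₁, ?_, he₂.diffeomorph_comp Φ₂, ?_, ?_, ?_⟩,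
    hΦ₁id, hΦ₂id, fun q hq => ?slide₁, fun q hq => ?slide₂⟩
  case slide₁ =>
    rw [hΦ₁ψ, hμ₁, NeckSlide.slideDiffeo_eq_self hc1 hq]
  case slide₂ =>
    rw [hΦ₂ψ, hμ₂, NeckSlide.slideDiffeo_eq_self hc1' hq]
  · rw [range_comp]; exact Φ₁.toHomeomorph.isOpenMap _ he₁o
  · rw [range_comp]; exact Φ₂.toHomeomorph.isOpenMap _ he₂o
  · -- the two ranges cover `P`
    refine eq_univ_of_forall fun p => ?_
    by_cases hp : p ∈ range ψ
    · obtain ⟨⟨θ, τ⟩, rfl⟩ := hp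
      by_cases hτ : -(1 / 2) < τ
      · -- in the range of `Φ₁ ∘ e₁`
        left
        set s := μ₁.symm τ with hs
        have hμs : μ₁ s = τ := μ₁.apply_symm_apply τ
        have hs0 : 0 < s := by
          by_contra h
          push Not at h
          have := (NeckSlide.strictMono_slideDiffeo hc1).monotone h
          rw [← hμ₁] at this
          rw [hμs, hμ₁0] at this
          linarith
        obtain ⟨a, -, ha⟩ := hc₁ θ s hs0
        refine ⟨a, ?_⟩
        change Φ₁ (e₁ a) = _
        rw [ha, hΦ₁ψ]
        change ψ (θ, μ₁ s) = ψ (θ, τ)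
        rw [hμs]
      · -- in the range of `Φ₂ ∘ e₂`
        right
        push Not at hτ
        set s := μ₂.symm τ with hs
        have hμs : μ₂ s = τ := μ₂.apply_symm_apply τ
        have hs0 : s < 0 := by
          by_contra h
          push Not at h
          have := (NeckSlide.strictMono_slideDiffeo hc1').monotone h
          rw [← hμ₂] at this
          rw [hμs, hμ₂0] at this
          linarith
        obtain ⟨b, -, hb⟩ := hc₂ θ (-s) (by linarith)
        refine ⟨b, ?_⟩
        change Φ₂ (e₂ b) = _
        rw [hb, hΦ₂ψ, neg_neg]
        change ψ (θ, μ₂ s) = ψ (θ, τ)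
        rw [hμs]
    · rcases em (p ∈ range e₁) with ⟨a, rfl⟩ | h₁
      · exact Or.inl ⟨a, by change Φ₁ (e₁ a) = e₁ a; exact hΦ₁id _ hp⟩
      rcases em (p ∈ range e₂) with ⟨b, rfl⟩ | h₂
      · exact Or.inr ⟨b, by change Φ₂ (e₂ b) = e₂ b; exact hΦ₂id _ hp⟩
      obtain ⟨θ, rfl⟩ := hcover p h₁ h₂
      exact absurd (mem_range_self _) hp
  · -- the gluing relation is Kervaire–Milnor's
    intro a b
    constructor
    · intro hab
      change Φ₁ (e₁ a) = Φ₂ (e₂ b) at hab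
      -- `e₁ a` lies on the neck
      have ha : e₁ a ∈ range ψ := by
        by_contra ha
        rw [hΦ₁id _ ha] at hab
        by_cases hb : e₂ b ∈ range ψ
        · obtain ⟨q, hq⟩ := hb
          rw [← hq, hΦ₂ψ] at hab
          exact ha (hab ▸ mem_range_self _)
        · rw [hΦ₂id _ hb] at hab
          exact Set.disjoint_left.1 hdisj (mem_range_self a) (hab ▸ mem_range_self b)
      obtain ⟨⟨θ, t⟩, hq⟩ := ha
      have ht : 0 < t := he₁ψ a θ t hq.symm
      -- so does `e₂ b`
      have hb : e₂ b ∈ range ψ := by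
        by_contra hb
        rw [hΦ₂id _ hb, ← hq, hΦ₁ψ] at hab
        exact hb (hab ▸ mem_range_self _)
      obtain ⟨⟨θ', s⟩, hq'⟩ := hb
      have hs : s < 0 := he₂ψ b θ' s hq'.symm
      rw [← hq, ← hq', hΦ₁ψ, hΦ₂ψ] at hab
      have hab' := hinj hab
      simp only [Prod.mk.injEq] at hab'
      obtain ⟨rfl, hts⟩ := hab'
      -- the common height `τ` lies in `(-½, ½)`
      have hτ₁ : -(1 / 2) < μ₁ t := by
        have := NeckSlide.sub_half_le_slideDiffeo hc1 t
        rw [← hμ₁] at this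
        linarith
      have hτ₂ : μ₂ s < 1 / 2 := by
        have := NeckSlide.slideDiffeo_le_add_half hc1' s
        rw [← hμ₂] at this
        linarith
      set τ := μ₁ t with hτ
      have ht' : t = τ + 1 / 2 := by
        apply (NeckSlide.strictMono_slideDiffeo hc1).injective
        rw [← hμ₁, ← hτ, hμ₁v (τ + 1 / 2) (by rw [abs_le]; constructor <;> linarith)]
        ring
      have hs' : s = τ - 1 / 2 := by
        apply (NeckSlide.strictMono_slideDiffeo hc1').injective
        rw [← hμ₂, ← hts, hμ₂v (τ - 1 / 2) (by rw [abs_le]; constructor <;> linarith)]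
        ring
      refine ⟨θ, t, mem_sphere_zero_iff_norm.1 θ.2, ⟨ht, by linarith⟩, he₁c a θ t ht hq.symm, ?_⟩
      refine he₂c b θ (1 - t) (by linarith) ?_
      rw [← hq']
      congr 2
      linarith
    · rintro ⟨u, t, hu, ht, ha, hb⟩
      set θ : sphere (0 : E) 1 := ⟨u, mem_sphere_zero_iff_norm.2 hu⟩ with hθ
      obtain ⟨a', ha', hea⟩ := hc₁ θ t ht.1
      have haa : a' = a := Subtype.ext (ha'.trans ha.symm)
      obtain ⟨b', hb', heb⟩ := hc₂ θ (1 - t) (by linarith [ht.2])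
      have hbb : b' = b := Subtype.ext (hb'.trans hb.symm)
      subst haa hbb
      change Φ₁ (e₁ a') = Φ₂ (e₂ b')
      rw [hea, heb, hΦ₁ψ, hΦ₂ψ]
      change ψ (θ, μ₁ t) = ψ (θ, μ₂ (-(1 - t)))
      rw [hμ₁v t (by rw [abs_le]; constructor <;> linarith [ht.1, ht.2]),
        hμ₂v (-(1 - t)) (by rw [abs_le]; constructor <;> linarith [ht.1, ht.2])]
      congr 2
      ring

end Main

/-! ### The dissolution manifold: explicit gluing embeddings, and their values far from the tube -/

namespace TwoKnot.TubularNbhd.DissolveSide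

open ToricBlowup SphereCoord TwoKnot.TubularNbhd

variable {K : TwoKnot} {ν : TwoKnot.TubularNbhd K}
  {Y : Type} [TopologicalSpace Y] [T2Space Y] [ChartedSpace (EuclideanSpace ℝ (Fin 4)) Y]
  [IsManifold (𝓡 4) ∞ Y] (S : DissolveSide ν Y)

/-- **The dissolution manifold is glued along the connected-sum relation by explicit embeddings
which are `S.eOne`, `S.eTwoM` off the neck.** For a side `S` of the dissolution (`Y` = the Gluck
twist or `S⁴`), `M = ν.Dissolve` is glued from `Y ∖ {jB p}` and `ℂℙ² ∖ {q}` along Kervaire–Milnor's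
relation for the discs `c₁ = jB ∘ discB`, `c₂ = cTwo` by the smooth embeddings
`(Φ₁ ∘ S.eOne, Φ₂ ∘ S.eTwoM)` with open ranges covering `M`, where `Φ₁`, `Φ₂` are diffeomorphisms of
`M` (neck slides) equal to the identity off the neck `S.j ∘ neckV` and far along it — the assembly
lemma `DissolveSide.isConnectedSum` / `dissolveSide_isOpenGluing_connectedSumRel` with the slides
retained (`exists_gluing_connectedSumRel_of_neck_explicit`).
[cite: Kosinski1993, Ch. VI §1 (p. 90; Prop. 1.3)] -/
theorem exists_gluing_connectedSumRel_explicit :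
    ∃ (Φ₁ Φ₂ : ν.Dissolve ≃ₘ⟮𝓡 4, 𝓡 4⟯ ν.Dissolve),
      (Manifold.IsSmoothEmbedding (𝓡 4) (𝓡 4) ∞ (Φ₁ ∘ S.eOne) ∧ IsOpen (range (Φ₁ ∘ S.eOne)) ∧
        Manifold.IsSmoothEmbedding (𝓡 4) (𝓡 4) ∞ (Φ₂ ∘ S.eTwoM) ∧
        IsOpen (range (Φ₂ ∘ S.eTwoM)) ∧
        range (Φ₁ ∘ S.eOne) ∪ range (Φ₂ ∘ S.eTwoM) = univ ∧
        ∀ a b, (Φ₁ ∘ S.eOne) a = (Φ₂ ∘ S.eTwoM) b ↔ connectedSumRel S.cOne cTwo a b) ∧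
      (∀ m, m ∉ range (S.j ∘ neckV) → Φ₁ m = m) ∧ (∀ m, m ∉ range (S.j ∘ neckV) → Φ₂ m = m) ∧
      (∀ q : sphere (0 : EuclideanSpace ℝ (Fin 4)) 1 × ℝ, 2 * NeckSlide.scale ≤ |q.2| →
        Φ₁ (S.j (neckV q)) = S.j (neckV q)) ∧
      (∀ q : sphere (0 : EuclideanSpace ℝ (Fin 4)) 1 × ℝ, 2 * NeckSlide.scale ≤ |q.2| →
        Φ₂ (S.j (neckV q)) = S.j (neckV q)) := by
  haveI := Fact.mk (@finrank_euclideanSpace_fin ℝ _ 4)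
  refine exists_gluing_connectedSumRel_of_neck_explicit (n := 3) S.cOne cTwo (ψ := S.j ∘ neckV)
    (e₁ := S.eOne) (e₂ := S.eTwoM) S.isSmoothEmbedding_neck ?_ S.isSmoothEmbedding_eOne
    S.isOpen_range_eOne S.isSmoothEmbedding_eTwoM S.isOpen_range_eTwoM S.disjoint_range
    S.neck_zero_not_mem_range_eOne S.neck_zero_not_mem_range_eTwoM
    (fun m h1 h2 => S.exists_neck_zero_eq h1 h2) (fun θ t ht => ?_) (fun θ t ht => ?_)
  · rw [range_comp]
    exact (IsOpenEmbedding.mk S.hj.isEmbedding S.hjo).isOpenMap _ isOpen_range_neckV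
  · have hne : discB (t • (θ : EuclideanSpace ℝ (Fin 4))) ≠ ToricBlowup.basePt :=
      discB_ne_basePt (smul_ne_zero ht.ne' (ne_zero_of_mem_unit_sphere θ))
    exact ⟨⟨S.jB (discB (t • (θ : EuclideanSpace ℝ (Fin 4)))), S.jB_mem_puncture hne⟩, rfl, by
      rw [S.eOne_jB hne, toModel_ΘB_discB_smul θ ht]; rfl⟩
  · have hmem : cTwo (t • (θ : EuclideanSpace ℝ (Fin 4))) ∈ puncture cTwo := by
      rw [mem_puncture]
      intro h
      have := isSmoothEmbedding_cTwo.isEmbedding.injective h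
      exact smul_ne_zero ht.ne' (ne_zero_of_mem_unit_sphere θ) this
    exact ⟨⟨cTwo (t • (θ : EuclideanSpace ℝ (Fin 4))), hmem⟩, rfl, by
      change S.j (eTwo (cTwo (t • (θ : EuclideanSpace ℝ (Fin 4))))) = S.j (neckV (θ, -t))
      rw [cTwo, eTwo_affine₂_smul' θ ht]⟩

omit [T2Space Y] [IsManifold (𝓡 4) ∞ Y] in
/-- **Far from the tube, `inl a` is not on the toric model.** If `a` lies in the piece `A` of the
knot complement and `(a : S⁴) ∉ range μ` (off the tubular neighbourhood), then `inl a ∉ range S.j`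
— the model part of `M` only meets `inl (A)` along the end of the tube (`S.hjrel`). [folklore] -/
theorem inl_notMem_range_j {a : K.complement} (ha : a ∈ ν.dissolveA)
    (hμ : (a : Metric.sphere (0 : EuclideanSpace ℝ (Fin 5)) 1) ∉ range S.μ) :
    ν.dissolveData.inl ⟨a, ha⟩ ∉ range S.j := by
  rintro ⟨v, hv⟩
  obtain ⟨b, -, -, hab⟩ := (S.hjrel ⟨a, ha⟩ v).1 hv.symm
  exact hμ ⟨S.T b, hab.symm⟩

omit [IsManifold (𝓡 4) ∞ Y] in
/-- **Far from the tube, the first embedding is `inl`.** For `a ∈ A` (in particular for every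
point of the knot complement off `range μ`), `S.jA a` lies in `Y ∖ {jB p}` and
`S.eOne (S.jA a) = inl a`. [folklore] -/
theorem eOne_jA_eq_inl {a : K.complement} (ha : a ∈ ν.dissolveA) :
    ∃ h : S.jA a ∈ (puncture S.cOne : Set Y), S.eOne ⟨S.jA a, h⟩ = ν.dissolveData.inl ⟨a, ha⟩ := by
  have hmem : S.jA a ∈ (puncture S.cOne : Set Y) := by
    rw [coe_puncture, mem_compl_iff, mem_singleton_iff, cOne_zero]
    intro h
    have := S.one_lt_of_rel ha h
    simp [ToricBlowup.basePt] at this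
    norm_num at this
  refine ⟨hmem, ?_⟩
  rw [S.eOne_of_mem_EA ((S.mem_EA_source_iff _).2 ⟨a, ha, rfl⟩)]
  exact S.EA_apply ha

end TwoKnot.TubularNbhd.DissolveSide

end Literature.Topology.FourManifolds

end
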